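import Summits.QuantumFields.QCD.Theses.ChiralSpinWaves
import HarnessLib.Audit

/-!
# Birth skeleton (BC3) for the crux `MassiveBody` (item stmt-QuantumFields-16583)

Route `ChiralSpinWaves` (sub-problem QCD), crux decl
`Summit.QuantumFields.QCD.Theses.ChiralSpinWaves.MassiveBody` (route rev 4, rank 4, deps ChiralTransfer):

  `∀ N_f ∈ {2,3}, ∀ reg : QCDRegularisation N_f, reg.HasMassScaling → (reg.scheme 0 0 0).HasAsymptoticScaling →
     (window laws: ∃ m₁ c C > 0, lower law ∧ upper law) →
       ∀ m > 0, ∃ z shift T, IsQCDAlong (reg.scheme m z shift) T ∧ T.IsNontrivial glue ∧ T.IsNonGaussian glue ∧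
         (∀ f ≠ g, T.IsNontrivial (pseudoRe f g)) ∧
         ∃ Δ > 0, T.HasMassGap Δ ∧ (reg.scheme m z shift).HasLatticeMassGap Δ`.

Registered by the skeleton-registrar seat `planner-skel-stmt-QuantumFields-16583-0` (route re-audit bin REPAIRABLE,
2026-08-17) as `Cruxes/MassiveBody/Lines/birth.lean`.  It is the route-level BIRTH CERTIFICATE of the crux (≥ 2 named
stubs, a kernel-checked composition concluding the crux BY NAME, `sorry` only inside `stub_*`), deliberately
LINE-NEUTRAL: it cuts the crux along the route header's own two-layer plan
("MassiveBody ⇐ UV existence for all m → gluonic/singlet gap above the window → OS packaging") into ONE ultraviolet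
piece and TWO infrared laws, all phrased over the Statement's vocabulary only (`IsQCDAlong`, `HasMassScaling`,
`HasAsymptoticScaling`, `HasLatticeMassGap`, `OSData.HasMassGap`, `IsNontrivial`, `IsNonGaussian`) plus the crux's own
window package, named here `WindowLaws = ∃ m₁ c C > 0, LowerLaw ∧ UpperLaw` (definitionally the crux's hypothesis):

* `stub_windowedContinuum : Stmt.stub_windowedContinuum` (S1, ULTRAVIOLET, open-problem) — for `N_f ∈ {2,3}` and EVERY
  regularisation with leading-log mass scaling, two-loop asymptotic scaling and the two window laws: continuum data at
  EVERY positive mass tuple — species renormalisations `z, shift` and OS data `T` with `IsQCDAlong (reg.scheme m z shift) T`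
  (limit along the FULL sequence), non-trivial non-Gaussian glue, non-decoupled flavour-changing pseudoscalars.  The crux's
  conclusion with its gap clause deleted; a formal consequence of the crux (weaker), not conversely.
* `stub_continuumClustering : Stmt.stub_continuumClustering` (S2, INFRARED-continuum, open-problem) — under the same hypotheses,
  EVERY `T` that is QCD along `reg.scheme m z shift` at a positive tuple `m` has SOME mass gap `Δ > 0` (`T.HasMassGap Δ`:
  uniform exponential clustering of all truncated Schwinger functions).  Stated `∀ T` (the limit is unique on the
  off-diagonal tensors that determine what `HasMassGap` tests; the vacuum junk limit `z ≡ 0` has every gap,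
  `OSData.vacuum_hasMassGap`).  NOT a consequence of the crux (which only gives `∃ T` with a gap).  Chosen INSTEAD of a
  lattice-to-continuum "gap inheritance" lemma `IsQCDAlong sch T → sch.HasLatticeMassGap Δ → T.HasMassGap Δ'`: as typed,
  `HasLatticeMassGap` bounds each pair of bounded-box observables separately, eventually in `k`, along the time axis only,
  which cannot control the smeared species fields (sums over `O(a_k⁻⁴)` translates) and the tree has no OS reconstruction —
  that lemma would be a trap dressed as an M-sized step; the honest content (cutoff-uniform clustering of massive lattice
  QCD in physical units, passed to the limit) is asked for directly here.
* `stub_latticeGapAboveWindow : Stmt.stub_latticeGapAboveWindow` (S3, INFRARED-lattice, open-problem, the "YM core with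
  intermediate / heavy dynamical quarks") — under the same hypotheses with the window constants `(m₁, c, C)` explicit:
  every positive tuple with SOME flavour above the window (`∃ f, m₁ < m_f`; the others may be arbitrarily light) has a
  uniform full-spectrum lattice gap `(reg.scheme m 0 0).HasLatticeMassGap Δ`, `Δ = Δ(m) > 0`.  Inside the window the
  lower law already supplies the lattice gap at the Goldstone rate `c√(inf_{f≠g}(m_f+m_g)) > 0`, so only the complement
  is asked.  A formal consequence of the crux (weaker).  Both laws are hypotheses on purpose: together they pin the
  flavour-blind additive offset of `m_crit` to the chiral point (lower law: no critical point inside the window; upper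
  law: none at negative or super-window renormalised mass), without which a ∀-reg lattice-gap law is false.

`MassiveBody_of : Stmt.stub_windowedContinuum → Stmt.stub_continuumClustering → Stmt.stub_latticeGapAboveWindow → MassiveBody` is
kernel-checked: (S1) gives `(z, shift, T)`; (S2) a continuum rate `Δ_T > 0` for that `T`; `latticeGap_all` a lattice rate
`Δ_L > 0` — by cases: inside the window from the lower law (positivity of the window rate: the index type
`{(f,g) // f ≠ g}` is finite and non-empty for `N_f ≥ 2`, `exists_eq_ciInf_of_finite`), above it from (S3) — moved to
the data's own scheme (`hasLatticeMassGap_scheme_iff`, `rfl`: the lattice clause reads only `β_k, m_f(k), L_k, a_k`);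
the common rate is `Δ := min Δ_T Δ_L` by `hasMassGap_mono` and `hasLatticeMassGap_mono` (both proved here).
`massiveBody_of_stubs : MassiveBody` instantiates it.

## CAVEAT on the crux as typed (flagged for the refuter / tenure planner; not a BC3 failure)
`MassiveBody` is a ∀-law over regularisations whose hypotheses are GAP BOUNDS (the window laws) but whose conclusion is a
CONVERGENCE statement (`IsQCDAlong`: limits along the full sequence `k → ∞`).  Gap bounds do not pin `m_crit(k)` beyond
`O(a_k m₁ / Z_m(k))`: if an honest window regularisation `reg₀` exists (the route's thesis), perturb
`m_crit(k) ↦ m_crit(k) + a_k δ_k / Z_m(k)` with `δ_k ∈ {0, δ}` alternating, `0 < δ ≤ m₁/2`.  The perturbed `reg₁` keeps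
`HasMassScaling` and asymptotic scaling (untouched), the lower law with `(m₁/2, c)` (at step `k` it is `reg₀` at the
tuple `m + δ_k·1 ≤ m₁`, whose gap rate dominates `c√(inf(m_f+m_g))`; two tuples, max of constants) and — physically —
the upper law with the same `C` (at every large EVEN `k` the honest pion correlator at `t·1` violates any rate `E > C√t`, i.e.
frequently in `k`), yet along `reg₁` the even and odd steps converge to continuum theories with DIFFERENT flavoured-meson
masses, so no `T` with non-decoupled pseudoscalars is `IsQCDAlong (reg₁.scheme m z shift)` for any species
renormalisation: the conclusion fails at `reg₁`.  Hence, in the world where ChiralWindow holds, MassiveBody as typed is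
physically FALSE (and where no window reg exists it is vacuous); the defect is confined to (S1) in this skeleton — (S2)
and (S3) are gap statements, robust under such perturbations.  It is not refutable in Lean without an honest
construction.  Suggested repair (planner's call, not done here): the ∃-form
`MassiveBody' := ChiralWindow → ∃ reg, HasMassScaling ∧ AF ∧ window laws ∧ massive body` (so `closes` reads
`IsChiralAtZero` and the body off the SAME existential reg), or a window-invisible re-pinning
`∃ m_crit'` (same `a, β, L, Z_m`) in the conclusion.

## Negative knowledge honoured (read 2026-08-17)
* `Cruxes/MassiveBody/` had NO workfiles before this one (no `Disproof.lean`, no ideas, no dead lines); the item carries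
  only grounder notes ("NEW / open-problem, Jaffe–Witten-grade; conclusion verbatim the massive body of `QCDOf`").
* `ledger negatives --problem QuantumFields` (5 entries: RobustYangMillsRG stmt-14958 and MirrorModularBoosts stmt-9665 —
  under-constrained bespoke admissibility predicates inhabited by wild witnesses; AdaptiveCoarseSystem stmt-9494;
  MultibosonLatticeGap stmt-9599 — unsatisfiable root-list clause; AdmissibleRootsExist stmt-9603).  Lesson applied: NO
  bespoke predicate is introduced; every stub is phrased over the Statement's vocabulary and the crux's own window
  package; no stub is an instance of a refuted statement (stmt-9599 is an `∃ reg` statement with a hand-made clause,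
  not of this shape).
* Junk witnesses: `z ≡ 0` vacuum data inhabit `IsQCDAlong` (`isQCDAlong_zeroAF_vacuum`) but NOT the non-decoupling
  clause of (S1) (`not_isNontrivial_vacuum`); in (S2) the vacuum instance satisfies the conclusion (`vacuum_hasMassGap`);
  (S3) concludes a lattice gap, read off honest lattice QCD only.
* Typing checklist 4c: no Bochner integral over a free function, no hand-picked threshold or rate (`Δ`, `Δ_T`, `Δ_L`
  existential; window constants universally quantified in (S3)), no determinantal / complex-action positivity claim.

## BC3 probes (planner folder `bc/`; rc and goals in NOTES.md and `Lines/birth.md`)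
For each stub statement `S`: `S → MassiveBody` and `S → QCD` by `first | exact? | simpa | aesop` and by
`first | exact? | simpa [S] | (unfold S; simpa) | aesop` — 12/12 FAIL (rc 1; `⊢ MassiveBody` / `⊢ QCD` unsolved after
aesop's exhaustive search, or deterministic timeout at 400000 heartbeats); per-atom re-runs of the crux direction
(`exact?`, `simpa`, `aesop`, `simpa [S]`, `unfold S; simpa`, `intro h; exact?`, each with its own 400000 heartbeats) —
18/18 FAIL.
-/

noncomputable section

namespace Summit.QuantumFields.QCD.Cruxes.MassiveBody.Birth

open scoped BigOperators Topology Classical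
open MeasureTheory Filter
open Literature.MathematicalPhysics.QuantumFieldTheory
open Summit.QuantumFields.QCD.Theses.ChiralSpinWaves

/-! ## §0 Currency — the crux's hypothesis and conclusion, named -/

/-- **Lower window law with constants `(m₁, c)`** (first conjunct of the window package of
`ChiralWindow` / of the hypothesis of `MassiveBody`, verbatim): every positive mass tuple in the
light-quark window `(0, m₁]^{N_f}` keeps the bare masses on the physical branch and has the uniform
lattice gap `c·√(inf_{f≠g} (m_f+m_g))` (the two lightest flavours make the lightest meson). -/
def LowerLaw (Nf : ℕ) (reg : QCDRegularisation Nf) (m₁ c : ℝ) : Prop :=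
  ∀ m : Fin Nf → ℝ, (∀ f, 0 < m f) → (∀ f, m f ≤ m₁) →
    (∀ f, ∀ᶠ k in Filter.atTop, (-1 : ℝ) < (reg.scheme m 0 0).mq f k) ∧
      (reg.scheme m 0 0).HasLatticeMassGap
        (c * Real.sqrt (⨅ p : {p : Fin Nf × Fin Nf // p.1 ≠ p.2}, (m p.1.1 + m p.1.2)))

/-- **Upper window law with constants `(m₁, C)`** (second conjunct, verbatim): on the degenerate
line `t·1`, `0 < t ≤ m₁`, there is NO uniform lattice gap at any rate `E > C√t` (the
pseudo-Goldstone mode propagates). -/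
def UpperLaw (Nf : ℕ) (reg : QCDRegularisation Nf) (m₁ C : ℝ) : Prop :=
  ∀ t : ℝ, 0 < t → t ≤ m₁ → ∀ E : ℝ, C * Real.sqrt t < E →
    ¬ (reg.scheme (fun _ => t) 0 0).HasLatticeMassGap E

/-- **The window laws of `reg`** — the third hypothesis of `MassiveBody`, verbatim up to the names
`LowerLaw` / `UpperLaw` (definitionally equal to it). -/
def WindowLaws (Nf : ℕ) (reg : QCDRegularisation Nf) : Prop :=
  ∃ m₁ > (0:ℝ), ∃ c > (0:ℝ), ∃ C > (0:ℝ), LowerLaw Nf reg m₁ c ∧ UpperLaw Nf reg m₁ C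

/-- **Continuum data of `reg` at EVERY positive mass tuple** — the conclusion of `MassiveBody` with
its gap clause deleted: species renormalisations `z, shift` and OS data `T` with
`IsQCDAlong (reg.scheme m z shift) T` (continuum limit along the FULL sequence `k → ∞`), non-trivial
and non-Gaussian glue, and non-decoupled flavour-changing pseudoscalars. -/
def ContinuumDataAll (Nf : ℕ) (reg : QCDRegularisation Nf) : Prop :=
  ∀ m : Fin Nf → ℝ, (∀ f, 0 < m f) →
    ∃ (z shift : QCDField Nf → ℕ → ℝ) (T : OSData (QCDField Nf) 4),
      IsQCDAlong (reg.scheme m z shift) T ∧ T.IsNontrivial QCDField.glue ∧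
        T.IsNonGaussian QCDField.glue ∧
          ∀ f g : Fin Nf, f ≠ g → T.IsNontrivial (QCDField.pseudoRe f g)

/-! ## §1 The three stub STATEMENTS — `def Stmt.stub_<name> : Prop`
Naming: the statement of the stub `stub_<name>` is the proposition `Stmt.stub_<name>`, so that `ledger skeleton check`
admits the hypotheses of `MassiveBody_of` as declared stubs BY NAME (crux workfiles may not carry `@[stub]` tags). -/

/-- **(S1) Windowed continuum — UV existence with light dynamical Wilson quarks at every positive
mass** (open-problem, the route header's node "UV existence for all m"). For `N_f ∈ {2,3}` and EVERY
regularisation `reg` with leading-log mass scaling, two-loop asymptotic scaling of its bare coupling and the two window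
laws (`WindowLaws`: the light-quark window has the two-sided Goldstone law on the lattice, which pins the flavour-blind
additive offset of `m_crit` to the chiral point and calibrates `Z_m`), lattice QCD along the bare trajectories
`m_f(k) = m_crit(k) + a_k m_f / Z_m(k)` has, at EVERY positive tuple `m`, a continuum limit along the full sequence:
species renormalisations `z, shift` and OS data `T` (E0, E0', E1–E4 as fields) with `IsQCDAlong (reg.scheme m z shift) T`,
non-trivial and non-Gaussian glue, and every flavour-changing pseudoscalar `Re ψ̄_f iγ₅ ψ_g`, `f ≠ g`, not a c-number
(`ContinuumDataAll`).  No gap is claimed.  Why plausibly true: this is the ultraviolet programme for SU(3) with light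
dynamical Wilson quarks (Bałaban-type block renormalisation group, fermionic cluster expansions, `m_crit` tuned inside
the flow, rotation invariance restored in the limit), for a regularisation whose chiral point is already fixed by the
window.  Why it might fail: (i) no block RG with a dynamical non-abelian field and Wilson quarks exists in `d = 4`;
E1 (rotations) and non-Gaussianity of the glue channel are each open; (ii) TYPED-FORM CAVEAT (see the module docstring):
the window laws are gap bounds and do not pin `m_crit(k)` finer than `O(a_k m₁/Z_m(k))`, so a window-invisible
oscillation of `m_crit` destroys convergence along the FULL sequence while keeping every hypothesis — as a ∀-reg law this
stub (like the crux) is physically false whenever an honest window regularisation exists; it is true in spirit for the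
honest one.  Size: open-problem (Jaffe–Witten-grade UV half).  Leans on: `IsQCDAlong`, `QCDRegularisation.scheme`,
`HasMassScaling`; Balaban1989LargeFieldII / BalabanOcarrollSchor1989 (block RG format), MontvayMunster1994 §5.1,
OsterwalderSeiler1978, Seiler1982 Ch. 3. -/
def Stmt.stub_windowedContinuum : Prop :=
  ∀ Nf : ℕ, Nf = 2 ∨ Nf = 3 → ∀ reg : QCDRegularisation Nf, reg.HasMassScaling →
    (reg.scheme 0 0 0).HasAsymptoticScaling → WindowLaws Nf reg → ContinuumDataAll Nf reg

/-- **(S2) Continuum clustering — every continuum limit along a window-pinned regularisation at a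
positive mass tuple clusters exponentially** (open-problem, infrared; the header's "OS packaging" made honest).
For `N_f ∈ {2,3}`, every window-pinned regularisation (as in (S1)), every positive tuple `m`, and EVERY `(z, shift, T)` with
`IsQCDAlong (reg.scheme m z shift) T`: `T` has a mass gap `Δ > 0` (`T.HasMassGap Δ`: uniform exponential clustering of
ALL truncated Schwinger functions of `T`, i.e. `σ(H) ⊆ {0} ∪ [Δ, ∞)`, `0` simple, on the full OS space of `T`).  Why
plausibly true: with the offset pinned to the chiral point by the window, every positive tuple is genuinely massive QCD
(lightest state: the pseudoscalar of the two lightest flavours, or a flavour-singlet / glueball state for heavy tuples),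
so the honest lattice theories cluster exponentially in PHYSICAL units, uniformly in the cutoff, for the smeared species
fields; such bounds pass to the `k → ∞` limits on the off-diagonal tensors and, by continuity of the Schwinger
functionals (`𝓢 →L[ℂ] ℂ`) and density, to all time-ordered test functions; `T` is unique on what `HasMassGap` tests, and
the junk limit (`z → 0`, vacuum data) has every gap (`OSData.vacuum_hasMassGap`).  Why it might fail: the cutoff-uniform
clustering of massive lattice QCD with light dynamical Wilson quarks is itself Millennium-grade infrared control (it is
the physical form of the lattice gap, stronger than the per-pair `HasLatticeMassGap`); a species renormalisation `z_s(k)`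
growing along the sequence could in principle inflate sub-leading slowly-clustering parts — excluded only if the honest
correlators' limits are themselves clustering.  Size: open-problem (infrared).  Leans on: `OSData.HasMassGap`,
`IsQCDAlong`; GlimmJaffe1987 §6.1 / §19 (clustering ⇔ gap), OsterwalderSeiler1978 §§2–4, Luscher1977 (transfer matrix). -/
def Stmt.stub_continuumClustering : Prop :=
  ∀ Nf : ℕ, Nf = 2 ∨ Nf = 3 → ∀ reg : QCDRegularisation Nf, reg.HasMassScaling →
    (reg.scheme 0 0 0).HasAsymptoticScaling → WindowLaws Nf reg →
      ∀ m : Fin Nf → ℝ, (∀ f, 0 < m f) →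
        ∀ (z shift : QCDField Nf → ℕ → ℝ) (T : OSData (QCDField Nf) 4),
          IsQCDAlong (reg.scheme m z shift) T → ∃ Δ : ℝ, 0 < Δ ∧ T.HasMassGap Δ

/-- **(S3) Lattice gap ABOVE the window — the Yang–Mills core with intermediate / heavy dynamical
quarks** (open-problem, infrared; the header's node "gluonic/singlet gap above the window"). For `N_f ∈ {2,3}`, every
regularisation with leading-log mass scaling and asymptotic scaling, and every window package with EXPLICIT constants
`(m₁, c, C)` — `LowerLaw N_f reg m₁ c` and `UpperLaw N_f reg m₁ C` — every positive tuple `m` with SOME flavour above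
the window, `∃ f, m₁ < m_f` (the other flavours may be anywhere in `(0, ∞)`, in particular arbitrarily light), has a
uniform full-spectrum LATTICE gap `(reg.scheme m 0 0).HasLatticeMassGap Δ` for some `Δ = Δ(m) > 0` (connected
Euclidean-time correlations of ALL pairs of gauge-invariant local lattice QCD observables — Wilson loops, mesons,
baryons — decay at rate `Δ a_k`, eventually in `k`, on every torus `2S+1 ≥ 2L_k+1`, uniformly in `S`).  Why plausibly
true: the two laws pin the additive offset of `m_crit` to the chiral point (the lower law forbids a critical point inside
the window, the upper law forbids one at negative or super-window renormalised mass), so above the window the bare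
trajectories are honest massive QCD with at least one intermediate / heavy flavour: gapped by the lightest meson of the
two lightest flavours (anomalous `U(1)_A` if only one flavour is light) or by the glueball / heavy-quarkonium scale —
the Yang–Mills core plus decoupling, uniformly in spacing and volume.  Why it might fail: it contains the lattice
Yang–Mills mass gap uniformly along an asymptotically scaling sequence (all tuples far above the window are YM + heavy
quarks); the intermediate "strange-like" regime `m₁ < m_f ≲ Λ` has neither a chiral nor a hopping expansion; `N_f = 3`
signed Wilson determinants enter the volume-uniform constants; the `(−1)^F`-twisted finite-torus functional.  Robust
under window-invisible perturbations of `m_crit` (a gap statement per tuple).  Size: open-problem (infrared,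
YM-core).  Leans on: `QCDScheme.HasLatticeMassGap`, `LowerLaw`, `UpperLaw`; JaffeWitten2000 §5, OsterwalderSeiler1978,
Seiler1982 Ch. 3, Luscher1977, Balaban1989LargeFieldII; pool twin: `Cruxes/MassiveBridge/Lines/birth.lean`
`HeavyQuarkLatticeGapStmt` (threshold form, stmt-QuantumFields-17577). -/
def Stmt.stub_latticeGapAboveWindow : Prop :=
  ∀ Nf : ℕ, Nf = 2 ∨ Nf = 3 → ∀ reg : QCDRegularisation Nf, reg.HasMassScaling →
    (reg.scheme 0 0 0).HasAsymptoticScaling →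
      ∀ m₁ c C : ℝ, 0 < m₁ → 0 < c → 0 < C → LowerLaw Nf reg m₁ c → UpperLaw Nf reg m₁ C →
        ∀ m : Fin Nf → ℝ, (∀ f, 0 < m f) → (∃ f, m₁ < m f) →
          ∃ Δ : ℝ, 0 < Δ ∧ (reg.scheme m 0 0).HasLatticeMassGap Δ

/-! ## §2 The registered stubs (the ONLY `sorry`s of this file) -/

/-- (S1) windowed continuum: UV existence, OS axioms, non-triviality and non-decoupling at every
positive mass along a window-pinned regularisation — open-problem. -/
theorem stub_windowedContinuum : Stmt.stub_windowedContinuum := by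
  sorry

/-- (S2) continuum clustering of every such continuum limit — open-problem (infrared). -/
theorem stub_continuumClustering : Stmt.stub_continuumClustering := by
  sorry

/-- (S3) uniform lattice gap above the light-quark window — open-problem (infrared, YM-core). -/
theorem stub_latticeGapAboveWindow : Stmt.stub_latticeGapAboveWindow := by
  sorry

/-! ## §3 Composition (kernel-checked; no `sorry` below this line) -/

/-- The lattice gap clause of a regularisation's scheme does not read the species renormalisations
`z, shift` (only `β_k, m_f(k), L_k, a_k`): definitional. [folklore] -/
theorem hasLatticeMassGap_scheme_iff {Nf : ℕ} (reg : QCDRegularisation Nf) (m : Fin Nf → ℝ)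
    (z shift : QCDField Nf → ℕ → ℝ) (Δ : ℝ) :
    (reg.scheme m z shift).HasLatticeMassGap Δ ↔ (reg.scheme m 0 0).HasLatticeMassGap Δ :=
  Iff.rfl

/-- **Monotonicity of the uniform lattice gap in the rate**: a lattice gap `Δ` is a lattice gap
`Δ' ≤ Δ` (constant replaced by `max C 0`; `a_k n ≥ 0`). [folklore] -/
theorem hasLatticeMassGap_mono {Nf : ℕ} (sch : QCDScheme Nf) {Δ Δ' : ℝ}
    (h : sch.HasLatticeMassGap Δ) (hle : Δ' ≤ Δ) : sch.HasLatticeMassGap Δ' := by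
  intro R R' A B
  obtain ⟨C, hC⟩ := h R R' A B
  refine ⟨max C 0, ?_⟩
  filter_upwards [hC] with k hk S hS n hn
  have h1 := hk S hS n hn
  have han : 0 ≤ sch.a k * (n : ℝ) := mul_nonneg (sch.a_pos k).le (Nat.cast_nonneg n)
  have hmul : Δ' * (sch.a k * (n : ℝ)) ≤ Δ * (sch.a k * (n : ℝ)) :=
    mul_le_mul_of_nonneg_right hle han
  have hexp : Real.exp (-(Δ * (sch.a k * n))) ≤ Real.exp (-(Δ' * (sch.a k * n))) :=
    Real.exp_le_exp.2 (by linarith)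
  exact h1.trans ((mul_le_mul_of_nonneg_right (le_max_left C 0) (Real.exp_pos _).le).trans
    (mul_le_mul_of_nonneg_left hexp (le_max_right C 0)))

/-- **Monotonicity of the OS mass gap in the rate**: uniform exponential clustering at rate `Δ` is
clustering at every rate `Δ' ≤ Δ` (`t ≥ 0`; constant replaced by `max C 0`). [folklore] -/
theorem hasMassGap_mono {ι : Type} {d : ℕ} [NeZero d] (T : OSData ι d) {Δ Δ' : ℝ}
    (h : T.HasMassGap Δ) (hle : Δ' ≤ Δ) : T.HasMassGap Δ' := by
  intro n m k k' F G hF hG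
  obtain ⟨C, hC⟩ := h n m k k' F G hF hG
  refine ⟨max C 0, fun t ht H hH => ?_⟩
  have h1 := hC t ht H hH
  have hmul : Δ' * t ≤ Δ * t := mul_le_mul_of_nonneg_right hle ht
  have hexp : Real.exp (-Δ * t) ≤ Real.exp (-Δ' * t) :=
    Real.exp_le_exp.2 (by linarith)
  exact h1.trans ((mul_le_mul_of_nonneg_right (le_max_left C 0) (Real.exp_pos _).le).trans
    (mul_le_mul_of_nonneg_left hexp (le_max_right C 0)))

/-- **The window rate is positive**: for `N_f ≥ 2` the index type `{(f,g) // f ≠ g}` is finite and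
non-empty, so the infimum of the pair sums of a positive tuple is attained and positive. [folklore] -/
theorem iInf_pairSum_pos {Nf : ℕ} (hN : 2 ≤ Nf) (m : Fin Nf → ℝ) (hm : ∀ f, 0 < m f) :
    0 < ⨅ p : {p : Fin Nf × Fin Nf // p.1 ≠ p.2}, (m p.1.1 + m p.1.2) := by
  haveI : Nonempty {p : Fin Nf × Fin Nf // p.1 ≠ p.2} :=
    ⟨⟨(⟨0, by omega⟩, ⟨1, by omega⟩), Fin.ne_of_val_ne (by norm_num)⟩⟩
  obtain ⟨p, hp⟩ := exists_eq_ciInf_of_finite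
    (f := fun p : {p : Fin Nf × Fin Nf // p.1 ≠ p.2} => m p.1.1 + m p.1.2)
  rw [← hp]
  exact add_pos (hm _) (hm _)

/-- **Lattice gap at every positive mass** from the window's lower law (inside the window, at the
Goldstone rate) and the stub (S3) (above the window). -/
theorem latticeGap_all (hIR : Stmt.stub_latticeGapAboveWindow) {Nf : ℕ} (hNf : Nf = 2 ∨ Nf = 3)
    (reg : QCDRegularisation Nf) (hms : reg.HasMassScaling)
    (haf : (reg.scheme 0 0 0).HasAsymptoticScaling) (hwin : WindowLaws Nf reg)
    (m : Fin Nf → ℝ) (hm : ∀ f, 0 < m f) :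
    ∃ Δ : ℝ, 0 < Δ ∧ (reg.scheme m 0 0).HasLatticeMassGap Δ := by
  obtain ⟨m₁, hm₁, c, hc, C, hC, hlow, hup⟩ := hwin
  by_cases hin : ∀ f, m f ≤ m₁
  · exact ⟨_, mul_pos hc (Real.sqrt_pos.2 (iInf_pairSum_pos (by omega) m hm)), (hlow m hm hin).2⟩
  · simp only [not_forall, not_le] at hin
    exact hIR Nf hNf reg hms haf m₁ c C hm₁ hc hC hlow hup m hm hin

/-- **The crux from the three stubs** (concludes `MassiveBody` BY NAME). For a window-pinned
regularisation and a positive tuple `m`: (S1) supplies `(z, shift, T)` with `IsQCDAlong`,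
non-trivial non-Gaussian glue and non-decoupled pseudoscalars; (S2) a continuum rate `Δ_T > 0` for
THAT `T`; the lower window law (inside the window) or (S3) (above it) a lattice rate `Δ_L > 0`,
moved to the data's own scheme by `hasLatticeMassGap_scheme_iff`; the common rate is
`Δ := min Δ_T Δ_L` by the two monotonicity lemmas. -/
theorem MassiveBody_of :
    Stmt.stub_windowedContinuum → Stmt.stub_continuumClustering → Stmt.stub_latticeGapAboveWindow →
      MassiveBody := by
  intro hUV hCl hIR
  unfold MassiveBody
  intro Nf hNf reg hms haf hwin m hm
  have hwin' : WindowLaws Nf reg := hwin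
  obtain ⟨z, shift, T, hqcd, hglue, hng, hps⟩ := hUV Nf hNf reg hms haf hwin' m hm
  obtain ⟨ΔT, hΔT, hTgap⟩ := hCl Nf hNf reg hms haf hwin' m hm z shift T hqcd
  obtain ⟨ΔL, hΔL, hLgap⟩ := latticeGap_all hIR hNf reg hms haf hwin' m hm
  have hLgap' : (reg.scheme m z shift).HasLatticeMassGap ΔL :=
    (hasLatticeMassGap_scheme_iff reg m z shift ΔL).2 hLgap
  exact ⟨z, shift, T, hqcd, hglue, hng, hps, min ΔT ΔL, lt_min hΔT hΔL,
    hasMassGap_mono T hTgap (min_le_left _ _), hasLatticeMassGap_mono _ hLgap' (min_le_right _ _)⟩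

/-- The crux along this skeleton, from the registered stubs (sorries only inside `stub_*`). -/
theorem massiveBody_of_stubs : MassiveBody :=
  MassiveBody_of stub_windowedContinuum stub_continuumClustering stub_latticeGapAboveWindow

end Summit.QuantumFields.QCD.Cruxes.MassiveBody.Birth

end
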